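import Literature.AlgebraicGeometry.CossartJannsenSaito2020.ProjDirProjectiveSpace
import Literature.AlgebraicGeometry.CossartJannsenSaito2020.ProjDirProjectiveLineCharts
import Literature.RingTheory.HilbertSamuel.ProjDirectrixSpace
import Literature.RingTheory.HilbertSamuel.ProjDirectrixSpaceChart
import Mathlib.RingTheory.Localization.FractionRing
import HarnessLib

/-!
# CJS LNM 2270, p. 103 L15–L17 / Def. 6.34 (i) for EVERY `t = e_x(X) ≥ 1`: the generic point of
# `C_1 = ℙ(Dir_x(X)) ≅ ℙ^{t−1}_{k(x)}` has residue field `k(x)(T_1, …, T_{t−1})` — PROOF, and the DISCHARGE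
# `ProjDir_projSpace_genericResidueField_holds`

Source: V. Cossart, U. Jannsen, S. Saito, *Desingularization: Invariants and Strategy*, LNM **2270** (2020)
[`CossartJannsenSaito2020`], p. 103 L15–L17 («Let `η_1` be the generic point of `C_1`. We note `C_1 ≃ ℙ^{t−1}_k`, where
`t = e^O_x(X)`»), L30–L31 / (6.24) (`δ_{η_1/x}`), Def. 6.34 (i) (p. 104). For a blow-up `π : X' → X` of a locally noetherian
`X` in a closed point `x` with `e_x(X) = t = q + 1` and a generic point `η` of `C = projDirectrixFibre π x`, this file
constructs an isomorphism `k(η) ≅ Frac(k(π η)[T_1, …, T_q])` (Mathlib `FractionRing (MvPolynomial (Fin q) _)`) under which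
`π^* : k(π η) → k(η)` is the inclusion of constants (`exists_residueField_iso_fractionRing_of_isGenericPoint`), which
DISCHARGES the named fact `ProjDir_projSpace_genericResidueField` (`ProjDirProjectiveSpace.lean`, p529373):
**`ProjDir_projSpace_genericResidueField_holds`**. The `t = 2` case is `ProjDirProjectiveLineResidueGeneric.lean` (`RatFunc`).

Proof. `η` lies on the chart `g : Spec D → X'` at one of the generators `c_{j_0}, …, c_{j_q}` adapted to the directrix
(`ProjDirectrixSpace.lean`: the exceptional ideal at a point of `ℙ(Dir)` is `(c_{j_0}, …, c_{j_q})`, invertible, hence ONE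
`c_{j_i}` generates it), say `η = g(w)`; on that chart `ℙ(Dir) = V(𝔑)` (`mem_projDirectrixFibre_chart_iff`) with
`D/𝔑 ≅ k(x)[T_1, …, T_q]`, `T_m ↦ c_{j_{m'}}/c_{j_i}` (`ProjDirectrixSpaceChart.lean`); `𝔑 ⊆ 𝔭_w`, and since `η` is generic
and `g(𝔑) ∈ ℙ(Dir)` specialises to it, `𝔭_w = 𝔑`. Let `t̄_m ∈ k(η)` be the values of the ratios. Evaluation
`k(πη)[T_1, …, T_q] → k(η)`, `T_m ↦ t̄_m`, is injective (a relation `p̄(t̄) = 0` lifts to `p(t) ∈ 𝔑` with `p ∈ Γ(U)[T]`, whence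
all coefficients of `p` lie in `𝔭_x`: `coeff_mem_of_eval₂_comp_mem_chartIdeal`) and every element of `k(η) = Frac(D/𝔑)` is
`p̄(t̄)/q̄(t̄)` (`exists_mvPolynomial_sub_eval₂_mem_chartIdeal`); so `IsFractionRing.lift` of the evaluation is an isomorphism
`Frac(k(πη)[T]) ≅ k(η)`.

NOT a statement of H. Hironaka's manuscript; a PROOF about a typed published statement of [CJS 2020] for the L-lane of
cell res-hironaka ([L W4.2] support, res-L1-w42-plan-1 RULING v3.14-16 (EN)). AI-written (res-type-031); weaker than expert
review.

## References

* V. Cossart, U. Jannsen, S. Saito, LNM 2270 (2020), Def. 6.34 (i), p. 103, p. 104. [CossartJannsenSaito2020]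
* The Stacks Project, Tag 0804 (charts of a blowing up). [StacksProject]
-/

noncomputable section

open CategoryTheory AlgebraicGeometry TopologicalSpace IsLocalRing
open Literature.AlgebraicGeometry.Resolution Literature.RingTheory.HilbertSamuel Literature.RingTheory.MvPolynomial

namespace Literature.AlgebraicGeometry.CossartJannsenSaito2020

universe u

/-! ## Plumbing (private copies of the chart lemmas of `ProjDirClosed.lean`) -/

/-- The chart `g_j : Spec (R[It])_{(c_j t)} → X'` of a blowing up along `C` over an affine open `U` at a member `c_j` of a
generating family `c` of `C(U)`: an open immersion over `Spec R → X` through `chartBase c j`, containing every point at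
which `c_j` generates the exceptional ideal. [cite: StacksProject, Tag 0804] -/
private theorem exists_chart_of_ideal_eq_span₇ {X' X : Scheme.{u}} {π : X' ⟶ X} {C : X.IdealSheafData}
    (hπ : IsBlowup π C) (U : X.affineOpens) {r : ℕ} (c : Fin r → Γ(X, U))
    (hc : C.ideal U = Ideal.span (Set.range c)) (j : Fin r) :
    ∃ g : Spec (.of (chartRing c j)) ⟶ X', IsOpenImmersion g ∧
      g ≫ π = Spec.map (CommRingCat.ofHom (chartBase c j)) ≫ U.2.fromSpec ∧
      ∀ (x' : X') (hx : π x' ∈ (U : X.Opens)),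
        stalkIdeal (C.comap π) x' =
            Ideal.span {(π.stalkMap x').hom ((X.presheaf.germ U (π x') hx).hom (c j))} →
          x' ∈ Set.range g := by
  have key : ∀ (I : Ideal Γ(X, U)) (_ : C.ideal U = I) (b : Γ(X, U)) (hb : b ∈ I),
      ∃ g : Spec (.of (HomogeneousLocalization.Away (reesGrading I) (reesT b hb))) ⟶ X',
        IsOpenImmersion g ∧
        g ≫ π = Spec.map (CommRingCat.ofHom (reesChartBase b hb)) ≫ U.2.fromSpec ∧
        ∀ (x' : X') (hx : π x' ∈ (U : X.Opens)),
          stalkIdeal (C.comap π) x' =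
              Ideal.span {(π.stalkMap x').hom ((X.presheaf.germ U (π x') hx).hom b)} →
            x' ∈ Set.range g := by
    rintro I rfl b hb
    obtain ⟨g, h1, h2, -⟩ := hπ.exists_charts U
    exact ⟨g b hb, h1 b hb, h2 b hb, fun x' hx hgen =>
      hπ.mem_range_chart_of_stalkIdeal_eq_span U hb (g b hb) (h2 b hb) hx hgen⟩
  exact key _ hc (c j) (Ideal.mem_span_range_self (f := c) (x := j))

/-- On a chart `g : Spec D → X'` with `g ≫ π = Spec f ≫ (Spec Γ(X, U) → X)`:
`g^♯_w ∘ π^♯_{g w} ∘ germ = (D → 𝒪_{Spec D, w}) ∘ f`. [cite: StacksProject, Tag 0804] -/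
private theorem stalkMap_stalkMap_germ_of_chart₇ {X' X : Scheme.{u}} (π : X' ⟶ X) (U : X.affineOpens)
    {D : CommRingCat.{u}} (g : Spec D ⟶ X') (f : Γ(X, U) ⟶ D)
    (hg : g ≫ π = Spec.map f ≫ U.2.fromSpec) (w : Spec D) (hx : π (g w) ∈ (U : X.Opens)) (r : Γ(X, U)) :
    (g.stalkMap w).hom ((π.stalkMap (g w)).hom ((X.presheaf.germ U (π (g w)) hx).hom r)) =
      ((Spec D).presheaf.germ ⊤ w trivial).hom ((Scheme.ΓSpecIso D).inv.hom (f.hom r)) := by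
  have e := top_le_preimage_of_chart U g f hg
  have h1 : ((Spec D).presheaf.germ ⊤ w trivial).hom ((g ≫ π).appLE U ⊤ e r) =
      ((g ≫ π).stalkMap w).hom ((X.presheaf.germ U ((g ≫ π) w) (e trivial)).hom r) := by
    change ((g ≫ π).appLE U ⊤ e ≫ (Spec D).presheaf.germ ⊤ w trivial).hom r =
      (X.presheaf.germ U ((g ≫ π) w) (e trivial) ≫ (g ≫ π).stalkMap w).hom r
    rw [Scheme.Hom.germ_stalkMap, Scheme.Hom.appLE, Category.assoc, (Spec D).presheaf.germ_res]
  rw [appLE_chart_eq U g f hg e, Scheme.Hom.stalkMap_comp] at h1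
  exact h1.symm

/-- **In a local ring, if `(u_1, …, u_r) = (t)` with `t` a nonzerodivisor, then `(u_j) = (t)` for some `j`.** [folklore] -/
private theorem exists_span_singleton_eq_of_span_range_eq₇ {B : Type u} [CommRing B] [IsLocalRing B] {r : ℕ}
    (u : Fin r → B) {t : B} (ht : t ∈ nonZeroDivisors B) (h : Ideal.span (Set.range u) = Ideal.span {t}) :
    ∃ j, Ideal.span {u j} = Ideal.span {t} := by
  classical
  have hb : ∀ l, ∃ b : B, b * t = u l := fun l =>
    Ideal.mem_span_singleton'.mp (h ▸ Ideal.subset_span ⟨l, rfl⟩)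
  choose b hb using hb
  obtain ⟨a, ha⟩ : ∃ a : Fin r → B, ∑ l, a l * u l = t :=
    Ideal.mem_span_range_iff_exists_fun.mp (h.symm ▸ Ideal.mem_span_singleton_self t)
  have hsum : ∑ l, a l * b l = 1 := by
    have h1 : (∑ l, a l * b l - 1) * t = 0 := by
      rw [sub_mul, one_mul, Finset.sum_mul, sub_eq_zero]
      conv_rhs => rw [← ha]
      exact Finset.sum_congr rfl fun l _ => by rw [mul_assoc, hb l]
    exact sub_eq_zero.mp ((mem_nonZeroDivisors_iff_right.mp ht) _ h1)
  have hex : ∃ j, IsUnit (a j * b j) := by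
    by_contra hall
    simp only [not_exists] at hall
    have hmem : ∑ l, a l * b l ∈ maximalIdeal B :=
      Ideal.sum_mem _ fun l _ => (mem_maximalIdeal _).mpr (mem_nonunits_iff.mpr (hall l))
    rw [hsum] at hmem
    exact (mem_maximalIdeal _).mp hmem isUnit_one
  obtain ⟨j, hj⟩ := hex
  refine ⟨j, ?_⟩
  have hbj : IsUnit (b j) := isUnit_of_mul_isUnit_right hj
  rw [← hb j, Ideal.span_singleton_mul_left_unit hbj]

/-- An ideal with quotient `≅ k[T_1, …, T_q]` (`k` a field) is prime. [folklore] -/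
private theorem isPrime_of_ringEquiv_mvPolynomial₇ {D : Type u} [CommRing D] {k : Type u} [Field k] {q : ℕ}
    (N : Ideal D) (Ξ : MvPolynomial (Fin q) k ≃+* D ⧸ N) : N.IsPrime := by
  haveI : IsDomain (D ⧸ N) := MulEquiv.isDomain (MvPolynomial (Fin q) k) Ξ.symm.toMulEquiv
  exact (Ideal.Quotient.isDomain_iff_prime N).mp inferInstance

/-! ## One chart: the residue field at a chart point where `D/𝔭_w` is a polynomial ring in `q` variables -/

section ChartResidue

variable {X' X : Scheme.{u}} (π : X' ⟶ X) (U : X.affineOpens)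
  {D : CommRingCat.{u}} (ψ : Γ(X, U) ⟶ D) (g : Spec D ⟶ X') [IsOpenImmersion g]
  (hgπ : g ≫ π = Spec.map ψ ≫ U.2.fromSpec) (w : Spec D) (hwU : π (g w) ∈ (U : X.Opens))
  (h𝔭max : (U.2.primeIdealOf ⟨π (g w), hwU⟩).asIdeal.IsMaximal) {q : ℕ} (t₀ : Fin q → D)
  (hinj : ∀ P : MvPolynomial (Fin q) Γ(X, U), MvPolynomial.eval₂ ψ.hom t₀ P ∈ w.asIdeal →
    ∀ μ, P.coeff μ ∈ (U.2.primeIdealOf ⟨π (g w), hwU⟩).asIdeal)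
  (hsurj : ∀ d : D, ∃ P : MvPolynomial (Fin q) Γ(X, U), d - MvPolynomial.eval₂ ψ.hom t₀ P ∈ w.asIdeal)

include hgπ h𝔭max hinj hsurj in
/-- **The residue field of `X'` at a chart point `g(w)` over a closed point, when `D/𝔭_w` is `k[t₀_1, …, t₀_q]` in the sense of
`hinj`/`hsurj`** (every element of `D` is a polynomial in the `t₀_m` over `Γ(X, U)` modulo `𝔭_w`, and such a polynomial lies in
`𝔭_w` only if its coefficients vanish at the point): `k(g w) ≅ Frac(k(π g w)[T_1, …, T_q])`, `T_m ↦ t̄₀_m`, compatibly with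
`π^*` (`IsFractionRing.lift` of the evaluation at `t̄₀`, injective by `hinj`, onto by `hsurj` and `𝒪_{Spec D,w} = D_w`). The
`q = 1` case is `exists_residueField_iso_ratFunc_of_chart`. [cite: CossartJannsenSaito2020, Def. 6.34 (i), p. 103] -/
theorem exists_residueField_iso_fractionRing_of_chart :
    ∃ e : X'.residueField (g w) ≅
        CommRingCat.of (FractionRing (MvPolynomial (Fin q) (X.residueField (π.base (g w))))),
      π.residueFieldMap (g w) ≫ e.hom =
        CommRingCat.ofHom ((algebraMap (MvPolynomial (Fin q) (X.residueField (π.base (g w))))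
          (FractionRing (MvPolynomial (Fin q) (X.residueField (π.base (g w)))))).comp MvPolynomial.C) := by
  classical
  -- the local dictionary at `w`
  let φ' : Γ(X, U) →+* X'.presheaf.stalk (g w) :=
    (π.stalkMap (g w)).hom.comp (X.presheaf.germ U (π.base (g w)) hwU).hom
  let σ : ↑(X'.presheaf.stalk (g w)) ≃+* ↑((Spec D).presheaf.stalk w) := (asIso (g.stalkMap w)).commRingCatIsoToRingEquiv
  have hσ : ∀ b, σ b = (g.stalkMap w).hom b := fun _ => rfl
  let τ : D ⟶ (Spec D).presheaf.stalk w := (Scheme.ΓSpecIso D).inv ≫ (Spec D).presheaf.germ ⊤ w trivial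
  letI : Algebra D ((Spec D).presheaf.stalk w) := τ.hom.toAlgebra
  haveI hlocL : IsLocalization.AtPrime ((Spec D).presheaf.stalk w) w.asIdeal :=
    StructureSheaf.IsLocalization.to_stalk (R := D) w
  have hστ : ∀ s : Γ(X, U), σ (φ' s) = τ.hom (ψ.hom s) := fun s =>
    stalkMap_stalkMap_germ_of_chart₇ π U g ψ hgπ w hwU s
  have hσm : ∀ b, b ∈ maximalIdeal (X'.presheaf.stalk (g w)) ↔ σ b ∈ maximalIdeal ((Spec D).presheaf.stalk w) := by
    intro b
    rw [mem_maximalIdeal, mem_maximalIdeal, mem_nonunits_iff, mem_nonunits_iff, MulEquiv.isUnit_map σ]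
  have hτw : ∀ d : D, d ∈ w.asIdeal ↔ τ.hom d ∈ maximalIdeal ((Spec D).presheaf.stalk w) :=
    fun d => (IsLocalization.AtPrime.to_map_mem_maximal_iff ((Spec D).presheaf.stalk w) w.asIdeal d).symm
  -- residue fields: `K₀ = k(π g w)`, `K₁ = k(g w)`, `ρ₀ : K₀ → K₁`
  set K₀ := X.residueField (π.base (g w)) with hK₀
  set K₁ := X'.residueField (g w) with hK₁
  let ρ₀ : K₀ →+* K₁ := (π.residueFieldMap (g w)).hom
  let res₁ : X'.presheaf.stalk (g w) →+* K₁ := (X'.residue (g w)).hom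
  let res₀ : X.presheaf.stalk (π.base (g w)) →+* K₀ := (X.residue (π.base (g w))).hom
  have hres : ∀ a', ρ₀ (res₀ a') = res₁ ((π.stalkMap (g w)).hom a') := by
    intro a'
    change (X.residue _ ≫ π.residueFieldMap (g w)).hom a' = (π.stalkMap (g w) ≫ X'.residue _).hom a'
    rw [Scheme.residue_residueFieldMap]
  have hres₁_zero : ∀ b, res₁ b = 0 ↔ b ∈ maximalIdeal (X'.presheaf.stalk (g w)) :=
    fun b => IsLocalRing.residue_eq_zero_iff b
  -- the coefficient map `χ : Γ(X, U) → K₀` is onto, with `𝔭 ⊆ ker`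
  set 𝔭 := (U.2.primeIdealOf ⟨π (g w), hwU⟩).asIdeal with h𝔭
  let χ : Γ(X, U) →+* K₀ := res₀.comp (X.presheaf.germ U (π.base (g w)) hwU).hom
  letI : Algebra Γ(X, U) (X.presheaf.stalk (π.base (g w))) :=
    TopCat.Presheaf.algebra_section_stalk X.presheaf (⟨π.base (g w), hwU⟩ : (U : X.Opens))
  haveI hlocη : IsLocalization.AtPrime (X.presheaf.stalk (π.base (g w))) 𝔭 := U.2.isLocalization_stalk ⟨π.base (g w), hwU⟩
  have hχsurj : Function.Surjective χ := by
    intro q'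
    obtain ⟨a₀, rfl⟩ := Ideal.Quotient.mk_surjective q'
    obtain ⟨⟨ρ, s⟩, hρs⟩ := IsLocalization.surj 𝔭.primeCompl a₀
    obtain ⟨y, i, hi, hyi⟩ := h𝔭max.exists_inv s.2
    refine ⟨y * ρ, ?_⟩
    change res₀ (algebraMap Γ(X, U) _ (y * ρ)) = res₀ a₀
    rw [← sub_eq_zero, ← map_sub]
    change IsLocalRing.residue _ _ = 0
    rw [IsLocalRing.residue_eq_zero_iff]
    have hs : a₀ * algebraMap Γ(X, U) _ s = algebraMap Γ(X, U) _ ρ := hρs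
    have h1 : algebraMap Γ(X, U) (X.presheaf.stalk (π.base (g w))) (y * ρ) - a₀ =
        -(algebraMap Γ(X, U) _ i * a₀) +
          (algebraMap Γ(X, U) _ y * algebraMap Γ(X, U) _ s + algebraMap Γ(X, U) _ i - 1) * a₀ := by
      rw [map_mul]
      linear_combination (-(algebraMap Γ(X, U) (X.presheaf.stalk (π.base (g w))) y)) * hs
    have h2 : algebraMap Γ(X, U) (X.presheaf.stalk (π.base (g w))) y * algebraMap Γ(X, U) _ s +
        algebraMap Γ(X, U) _ i - 1 = 0 := by
      rw [← map_mul, ← map_add, hyi, map_one, sub_self]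
    rw [h1, h2, zero_mul, add_zero]
    exact Submodule.neg_mem _ (Ideal.mul_mem_right _ _
      ((IsLocalization.AtPrime.to_map_mem_maximal_iff _ 𝔭 i).mpr hi))
  have hχker : ∀ ρ ∈ 𝔭, χ ρ = 0 := by
    intro ρ hρ
    change IsLocalRing.residue _ (algebraMap Γ(X, U) (X.presheaf.stalk (π.base (g w))) ρ) = 0
    rw [IsLocalRing.residue_eq_zero_iff]
    exact (IsLocalization.AtPrime.to_map_mem_maximal_iff _ 𝔭 ρ).mpr hρ
  -- `t̄ ∈ K₁^q` and the evaluation map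
  set t : Fin q → K₁ := fun m => res₁ (σ.symm (τ.hom (t₀ m))) with ht
  let ev : MvPolynomial (Fin q) K₀ →+* K₁ := MvPolynomial.eval₂Hom ρ₀ t
  -- evaluating a lifted polynomial: `ev (P.map χ) = res₁ (σ⁻¹ τ (P(t₀)))`
  have hev : ∀ P : MvPolynomial (Fin q) Γ(X, U),
      ev (MvPolynomial.map χ P) = res₁ (σ.symm (τ.hom (MvPolynomial.eval₂ ψ.hom t₀ P))) := by
    intro P
    have hhom : ev.comp (MvPolynomial.map χ) =
        (res₁.comp ((σ.symm : _ →+* _).comp τ.hom)).comp (MvPolynomial.eval₂Hom ψ.hom t₀) := by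
      refine MvPolynomial.ringHom_ext (fun r => ?_) (fun m => ?_)
      · change ev (MvPolynomial.map χ (MvPolynomial.C r)) =
          res₁ (σ.symm (τ.hom (MvPolynomial.eval₂Hom ψ.hom t₀ (MvPolynomial.C r))))
        rw [MvPolynomial.map_C, MvPolynomial.eval₂Hom_C, MvPolynomial.eval₂Hom_C]
        change ρ₀ (res₀ _) = _
        rw [hres, ← hστ r, σ.symm_apply_apply]
        rfl
      · change ev (MvPolynomial.map χ (MvPolynomial.X m)) =
          res₁ (σ.symm (τ.hom (MvPolynomial.eval₂Hom ψ.hom t₀ (MvPolynomial.X m))))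
        rw [MvPolynomial.map_X, MvPolynomial.eval₂Hom_X', MvPolynomial.eval₂Hom_X']
    exact RingHom.congr_fun hhom P
  -- (T) `t̄` is algebraically independent over `K₀`: `ev` is injective
  have hT : ∀ p : MvPolynomial (Fin q) K₀, ev p = 0 → p = 0 := by
    intro p hp
    obtain ⟨P, rfl⟩ := MvPolynomial.map_surjective χ hχsurj p
    rw [hev, hres₁_zero, hσm, σ.apply_symm_apply, ← hτw] at hp
    have hcoef := hinj P hp
    ext μ
    rw [MvPolynomial.coeff_map, MvPolynomial.coeff_zero]
    exact hχker _ (hcoef μ)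
  have hevinj : Function.Injective ev := by
    rw [injective_iff_map_eq_zero]
    exact hT
  set F := FractionRing (MvPolynomial (Fin q) K₀) with hF
  let Ψ : F →+* K₁ := IsFractionRing.lift hevinj
  have hΨalg : ∀ p : MvPolynomial (Fin q) K₀, Ψ (algebraMap (MvPolynomial (Fin q) K₀) F p) = ev p :=
    fun p => IsFractionRing.lift_algebraMap hevinj p
  -- (S) `Ψ` is onto
  have hΨsurj : Function.Surjective Ψ := by
    intro z
    obtain ⟨b, rfl⟩ := IsLocalRing.residue_surjective z
    obtain ⟨⟨d, s⟩, hds⟩ := IsLocalization.surj w.asIdeal.primeCompl (σ b)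
    obtain ⟨Pd, hPd⟩ := hsurj d
    obtain ⟨Ps, hPs⟩ := hsurj (s : D)
    have hvd : res₁ (σ.symm (τ.hom d)) = ev (MvPolynomial.map χ Pd) := by
      rw [hev, ← sub_eq_zero, ← map_sub, ← map_sub, ← map_sub, hres₁_zero, hσm, σ.apply_symm_apply, ← hτw]
      exact hPd
    have hvs : res₁ (σ.symm (τ.hom (s : D))) = ev (MvPolynomial.map χ Ps) := by
      rw [hev, ← sub_eq_zero, ← map_sub, ← map_sub, ← map_sub, hres₁_zero, hσm, σ.apply_symm_apply, ← hτw]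
      exact hPs
    have hvs0 : res₁ (σ.symm (τ.hom (s : D))) ≠ 0 := by
      rw [Ne, hres₁_zero, hσm, σ.apply_symm_apply, ← hτw]
      exact s.2
    have hbds : b * σ.symm (τ.hom (s : D)) = σ.symm (τ.hom d) := by
      apply σ.injective
      rw [map_mul, σ.apply_symm_apply, σ.apply_symm_apply]
      exact hds
    refine ⟨algebraMap (MvPolynomial (Fin q) K₀) F (MvPolynomial.map χ Pd) /
      algebraMap (MvPolynomial (Fin q) K₀) F (MvPolynomial.map χ Ps), ?_⟩
    change Ψ _ = res₁ b
    rw [map_div₀, hΨalg, hΨalg, ← hvd, ← hvs, div_eq_iff hvs0, ← hbds, map_mul]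
  have hΨbij : Function.Bijective Ψ := ⟨Ψ.injective, hΨsurj⟩
  let e₀ : F ≃+* K₁ := RingEquiv.ofBijective Ψ hΨbij
  refine ⟨e₀.symm.toCommRingCatIso, ?_⟩
  ext a
  change e₀.symm (ρ₀ a) = algebraMap (MvPolynomial (Fin q) K₀) F (MvPolynomial.C a)
  rw [RingEquiv.symm_apply_eq]
  change ρ₀ a = Ψ (algebraMap (MvPolynomial (Fin q) K₀) F (MvPolynomial.C a))
  rw [hΨalg, MvPolynomial.eval₂Hom_C]

end ChartResidue

/-! ## The theorem -/

set_option maxHeartbeats 1600000 in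
-- one long proof over large chart types (`q + 1` Rees charts `chartRing c j` over `Γ(X, U)`), as in `ProjDirLine.lean`
/-- **CJS 2020, p. 103 L15–L17 / Def. 6.34 (i) for every `t = e_x(X) = q + 1`, generic point of `C_1 ≅ ℙ^{t−1}_{k(x)}`,
PROVED: `k(η_1) ≅ k(x)(T_1, …, T_q)`** — for a blow-up `π : X' ⟶ X` of a locally noetherian `X` in a closed point `x` with
`e_x(X) = q + 1` and a generic point `η` of `projDirectrixFibre π x`, there is an isomorphism `k(η) ≅ Frac(k(π η)[T_1, …, T_q])`
under which `π^* : k(π η) → k(η)` becomes the inclusion of constants (`δ_{η_1/x} = t − 1`, p. 103 L30 / (6.24)).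
[cite: CossartJannsenSaito2020, Def. 6.34 (i), p. 103] -/
theorem exists_residueField_iso_fractionRing_of_isGenericPoint {X X' : Scheme.{u}} [IsLocallyNoetherian X]
    (π : X' ⟶ X) (x : X) (hx : IsClosed ({x} : Set X))
    (hπ : IsBlowup π (Scheme.IdealSheafData.vanishingIdeal ⟨{x}, hx⟩)) {q : ℕ}
    (hdir : Scheme.dirDim X x = q + 1) (η : X') (hη : IsGenericPoint η (projDirectrixFibre π x)) :
    ∃ e : X'.residueField η ≅ CommRingCat.of (FractionRing (MvPolynomial (Fin q) (X.residueField (π.base η)))),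
      π.residueFieldMap η ≫ e.hom =
        CommRingCat.ofHom ((algebraMap (MvPolynomial (Fin q) (X.residueField (π.base η)))
          (FractionRing (MvPolynomial (Fin q) (X.residueField (π.base η))))).comp MvPolynomial.C) := by
  classical
  set S := projDirectrixFibre π x with hS
  -- (0) the centre, an affine open `U ∋ x`, `𝔭 = 𝔭_x ⊆ R = Γ(X, U)`, `𝒪_{X,x} = R_𝔭`
  obtain ⟨U, hxU⟩ : ∃ U : X.affineOpens, x ∈ (U : X.Opens) := by
    obtain ⟨U₀, hU, hxU, -⟩ :=
      exists_isAffineOpen_mem_and_subset (X := X) (x := x) (U := ⊤) (Opens.mem_top x)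
    exact ⟨⟨U₀, hU⟩, hxU⟩
  set A := X.presheaf.stalk x with hA
  obtain ⟨𝔭, h𝔭⟩ : ∃ 𝔭 : PrimeSpectrum Γ(X, U), 𝔭 = U.2.primeIdealOf ⟨x, hxU⟩ := ⟨_, rfl⟩
  haveI h𝔭max : 𝔭.asIdeal.IsMaximal := h𝔭 ▸ U.2.primeIdealOf_isMaximal_of_isClosed ⟨x, hxU⟩ hx
  haveI : IsNoetherianRing Γ(X, U) := IsLocallyNoetherian.component_noetherian U
  letI : Algebra Γ(X, U) A := TopCat.Presheaf.algebra_section_stalk X.presheaf (⟨x, hxU⟩ : (U : X.Opens))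
  haveI hloc : IsLocalization.AtPrime A 𝔭.asIdeal := h𝔭 ▸ U.2.isLocalization_stalk ⟨x, hxU⟩
  have halg : ∀ s : Γ(X, U), algebraMap Γ(X, U) A s = (X.presheaf.germ U x hxU).hom s := fun _ => rfl
  have hI : (Scheme.IdealSheafData.vanishingIdeal (⟨{x}, hx⟩ : Closeds X)).ideal U = 𝔭.asIdeal := by
    rw [h𝔭]
    exact vanishingIdeal_singleton_ideal U.2 hx hxU
  obtain ⟨r, c, hc⟩ : ∃ (r : ℕ) (c : Fin r → Γ(X, U)), Ideal.span (Set.range c) = 𝔭.asIdeal :=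
    Submodule.fg_iff_exists_fin_generating_family.mp (IsNoetherian.noetherian 𝔭.asIdeal)
  have hIc : (Scheme.IdealSheafData.vanishingIdeal (⟨{x}, hx⟩ : Closeds X)).ideal U = Ideal.span (Set.range c) :=
    hI.trans hc.symm
  have hcm : ∀ l, algebraMap Γ(X, U) A (c l) ∈ maximalIdeal A :=
    fun l => (IsLocalization.AtPrime.to_map_mem_maximal_iff A 𝔭.asIdeal (c l)).mpr
      (hc ▸ Ideal.subset_span ⟨l, rfl⟩)
  have hspanA : Ideal.span (Set.range fun l => algebraMap Γ(X, U) A (c l)) = maximalIdeal A := by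
    have h := IsLocalization.AtPrime.map_eq_maximalIdeal 𝔭.asIdeal A
    rwa [← hc, Ideal.map_span, ← Set.range_comp] at h
  have hexp : ∀ l, ∃ a : Fin (maximalIdeal A).spanFinrank → A,
      ∑ i, a i * minGenerators A i = algebraMap Γ(X, U) A (c l) :=
    fun l => Ideal.mem_span_range_iff_exists_fun.mp (by rw [span_range_minGenerators]; exact hcm l)
  choose a ha using hexp
  have ha' : ∀ l, algebraMap Γ(X, U) A (c l) = ∑ i, a l i * minGenerators A i := fun l => (ha l).symm
  have hd : directrixDim (tangentConeIdeal (minGenerators A) (span_range_minGenerators A)) = q + 1 := hdir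
  -- (1) the charts at the generators, and the chart description of `S`
  have hcharts := fun j => exists_chart_of_ideal_eq_span₇ hπ U c hIc j
  choose g hgopen hgπ hgmem using hcharts
  have hkey : ∀ (j : Fin r) (w : Spec (.of (chartRing c j))),
      g j w ∈ S ↔
        ((U.2.primeIdealOf ⟨x, hxU⟩).asIdeal.map (CommRingCat.ofHom (chartBase c j)).hom ⊔
          Ideal.span {d : chartRing c j | ∃ lam : Fin r → Γ(X, U),
            (linForm fun i => ∑ l, residue (X.presheaf.stalk x) ((X.presheaf.germ U x hxU).hom (lam l)) *
                residue (X.presheaf.stalk x) (a l i)) ∈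
              directrixSpace (canonicalTangentConeIdeal (X.presheaf.stalk x)) ∧
            d = ∑ l, (CommRingCat.ofHom (chartBase c j)).hom (lam l) * chartGen c j l}) ≤ w.asIdeal := by
    intro j w
    haveI := hgopen j
    exact mem_projDirectrixFibre_chart_iff π U hxU (CommRingCat.ofHom (chartBase c j)) c j
      (fun l => chartGen c j l) a (g j) (hgπ j) (fun k => reesChartBase_apply_eq_mul_chartGen c j k)
      (reesChartBase_mem_nonZeroDivisors (c j) (Ideal.mem_span_range_self (f := c) (x := j))) hx
      (h𝔭 ▸ hc) ha w
  -- (2) an adapted family of generators `c_{j_0}, …, c_{j_q}`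
  obtain ⟨j, hjs, hji⟩ := exists_family_symbols_basis_mod_directrixSpace (span_range_minGenerators A) rfl hspanA a ha' hd
  -- (3) per-chart structure: `S ∩ chart = V(N)`, `D/N ≅ k(x)[T_1, …, T_q]`, with INJ / SURJ of `Γ(X, U)[T] → D/N`
  letI instF : Field (Γ(X, U) ⧸ 𝔭.asIdeal) := Ideal.Quotient.field 𝔭.asIdeal
  have hchart : ∀ i₀ : Fin (q + 1),
      ∃ (N : Ideal (chartRing c (j i₀)))
        (_ : MvPolynomial (Fin q) (Γ(X, U) ⧸ 𝔭.asIdeal) ≃+* chartRing c (j i₀) ⧸ N),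
        (∀ w : Spec (.of (chartRing c (j i₀))), g (j i₀) w ∈ S ↔ N ≤ w.asIdeal) ∧ N.IsPrime ∧
        (∀ p : MvPolynomial (Fin q) Γ(X, U),
          MvPolynomial.eval₂ (chartBase c (j i₀)) (fun m => chartGen c (j i₀) (j (i₀.succAbove m))) p ∈ N →
            ∀ μ, p.coeff μ ∈ 𝔭.asIdeal) ∧
        (∀ d : chartRing c (j i₀), ∃ p : MvPolynomial (Fin q) Γ(X, U),
          d - MvPolynomial.eval₂ (chartBase c (j i₀)) (fun m => chartGen c (j i₀) (j (i₀.succAbove m))) p ∈ N) := by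
    intro i₀
    obtain ⟨hsp, hind⟩ := basis_mod_directrixSpace_succAbove (span_range_minGenerators A) a hjs hji i₀
    obtain ⟨Ξ, -, -⟩ := exists_ringEquiv_mvPolynomial_quotient_chartIdeal 𝔭.asIdeal A
      (span_range_minGenerators A) a ha (chartBase c (j i₀)) (fun l => chartGen c (j i₀) l) (j i₀)
      (fun m => j (i₀.succAbove m)) (chartGen_self c (j i₀))
      (fun d => exists_isHomogeneous_eval₂_eq c (j i₀) d)
      (fun m F hF => reesChartBase_eval_eq_pow_mul_eval₂ c (j i₀) hF)
      (fun z hz => exists_pow_mul_eq_zero_of_reesChartBase_eq_zero c (j i₀) hz) hsp hind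
    refine ⟨_, Ξ, fun w => ?_, isPrime_of_ringEquiv_mvPolynomial₇ _ Ξ, fun p hp μ => ?_, fun d => ?_⟩
    · rw [hkey (j i₀) w, h𝔭]
      exact Iff.rfl
    · exact coeff_mem_of_eval₂_comp_mem_chartIdeal 𝔭.asIdeal A (span_range_minGenerators A) a ha
        (chartBase c (j i₀)) (fun l => chartGen c (j i₀) l) (j i₀) (fun m => j (i₀.succAbove m))
        (chartGen_self c (j i₀)) (fun d => exists_isHomogeneous_eval₂_eq c (j i₀) d)
        (fun m F hF => reesChartBase_eval_eq_pow_mul_eval₂ c (j i₀) hF)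
        (fun z hz => exists_pow_mul_eq_zero_of_reesChartBase_eq_zero c (j i₀) hz) hsp hind hp μ
    · exact exists_mvPolynomial_sub_eval₂_mem_chartIdeal 𝔭.asIdeal A (span_range_minGenerators A) a
        (chartBase c (j i₀)) (fun l => chartGen c (j i₀) l) (j i₀) (fun m => j (i₀.succAbove m))
        (chartGen_self c (j i₀)) (fun d => exists_isHomogeneous_eval₂_eq c (j i₀) d) hsp d
  choose N Ξ hkeyN hprimeN hinjN hsurjN using hchart
  -- (4) every point of `S` lies on one of the `q + 1` charts
  have hcover : ∀ ξ ∈ S, ∃ i, ξ ∈ Set.range (g (j i)) := by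
    intro ξ hξ
    obtain ⟨hξx, hP⟩ := (mem_projDirectrixFibre π x ξ).mp hξ
    have hξU : π.base ξ ∈ (U : X.Opens) := hξx ▸ hxU
    let ι : A ≅ X.presheaf.stalk (π.base ξ) := X.presheaf.stalkCongr (.of_eq hξx.symm)
    haveI : IsLocalHom (π.stalkMap ξ).hom := π.toLRSHom.prop ξ
    let φ : A →+* X'.presheaf.stalk ξ := (π.stalkMap ξ).hom.comp ι.hom.hom
    have hφgerm : ∀ s : Γ(X, U), φ (algebraMap Γ(X, U) A s) =
        (π.stalkMap ξ).hom ((X.presheaf.germ U (π.base ξ) hξU).hom s) := by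
      intro s
      rw [halg, RingHom.comp_apply]
      change (π.stalkMap ξ).hom ((X.presheaf.germ U x hxU ≫ ι.hom).hom s) = _
      rw [TopCat.Presheaf.stalkCongr_hom, TopCat.Presheaf.germ_stalkSpecializes]
    have hφm : (maximalIdeal A).map φ ≤ maximalIdeal (X'.presheaf.stalk ξ) := by
      rw [Ideal.map_le_iff_le_comap]
      intro m hm
      rw [Ideal.mem_comap, RingHom.comp_apply]
      refine map_nonunit (π.stalkMap ξ).hom _ ?_
      rw [mem_maximalIdeal, mem_nonunits_iff] at hm ⊢
      have h2 : ι.inv.hom (ι.hom.hom m) = m := by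
        change (ι.hom ≫ ι.inv).hom m = m
        rw [Iso.hom_inv_id]
        rfl
      exact fun hu => hm (h2 ▸ hu.map ι.inv.hom)
    have hPφ : ProjDirLiftsInto φ (minGenerators A) (span_range_minGenerators A) :=
      (isOnProjDirectrix_iff_projDirLiftsInto π hξx).mp hP
    have hfam := map_maximalIdeal_eq_span_family_of_projDirLiftsInto (span_range_minGenerators A) a ha' hjs φ hφm hPφ
    obtain ⟨t, ht, hKt⟩ := hπ.isEffectiveCartier.exists_stalkIdeal_eq_span ξ
    have hK : stalkIdeal ((Scheme.IdealSheafData.vanishingIdeal (⟨{x}, hx⟩ : Closeds X)).comap π) ξ =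
        Ideal.span (Set.range fun i => (π.stalkMap ξ).hom ((X.presheaf.germ U (π.base ξ) hξU).hom (c (j i)))) := by
      rw [stalkIdeal_comap_eq_map, stalkIdeal_eq_map_germ _ U hξU, hIc, Ideal.map_map, Ideal.map_span,
        ← Set.range_comp]
      have h1 : Ideal.span (Set.range (((π.stalkMap ξ).hom.comp (X.presheaf.germ U (π.base ξ) hξU).hom) ∘ c)) =
          (maximalIdeal A).map φ := by
        rw [← hspanA, Ideal.map_span, ← Set.range_comp]
        exact congrArg Ideal.span (congrArg Set.range (funext fun l => (hφgerm (c l)).symm))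
      rw [h1, hfam]
      exact congrArg Ideal.span (congrArg Set.range (funext fun i => hφgerm (c (j i))))
    obtain ⟨i, hi⟩ := exists_span_singleton_eq_of_span_range_eq₇ _ ht (hK.symm.trans hKt)
    exact ⟨i, hgmem (j i) ξ hξU (hKt.trans hi.symm)⟩
  -- (5) `η` on a chart: `η = g_{j_i}(w)` with `𝔭_w = N_i` (`N_i ≤ 𝔭_w`; `g(N_i) ∈ S` and `η` is generic)
  obtain ⟨i, w, hw⟩ := hcover η hη.mem
  haveI := hgopen (j i)
  set ηpt : Spec (.of (chartRing c (j i))) := ⟨N i, hprimeN i⟩ with hηpt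
  have hηS : g (j i) ηpt ∈ S := (hkeyN i ηpt).mpr le_rfl
  have hNw : N i ≤ w.asIdeal := (hkeyN i w).mp (hw.symm ▸ hη.mem)
  have h2 : η ⤳ g (j i) ηpt := hη.specializes hηS
  have h3 : w ⤳ ηpt := by
    rw [← hw] at h2
    exact ((g (j i)).isOpenEmbedding.toIsInducing.specializes_iff).mp h2
  have hwN : w.asIdeal = N i :=
    le_antisymm ((PrimeSpectrum.asIdeal_le_asIdeal w ηpt).mpr ((PrimeSpectrum.le_iff_specializes w ηpt).mpr h3)) hNw
  -- (6) the residue field computation on the chart at `c_{j_i}`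
  subst hw
  have hwx : π.base (g (j i) w) = x := ((mem_projDirectrixFibre π x _).mp hη.mem).1
  have hwU : π.base (g (j i) w) ∈ (U : X.Opens) := hwx ▸ hxU
  have h𝔭eq : (U.2.primeIdealOf ⟨π (g (j i) w), hwU⟩).asIdeal = 𝔭.asIdeal := by
    rw [h𝔭]
    congr 2
    exact Subtype.ext hwx
  have h𝔭max' : (U.2.primeIdealOf ⟨π (g (j i) w), hwU⟩).asIdeal.IsMaximal := h𝔭eq ▸ h𝔭max
  refine exists_residueField_iso_fractionRing_of_chart π U (CommRingCat.ofHom (chartBase c (j i))) (g (j i)) (hgπ (j i))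
    w hwU h𝔭max' (fun m => chartGen c (j i) (j (i.succAbove m))) (fun P hP μ => ?_) (fun d => ?_)
  · rw [h𝔭eq]
    rw [hwN] at hP
    exact hinjN i P hP μ
  · obtain ⟨P, hP⟩ := hsurjN i d
    exact ⟨P, hNw hP⟩

/-- **CJS 2020, p. 103 L15–L17 / Def. 6.34 (i) for every `t = e_x(X) ≥ 1`, the function field of
`C_1 = ℙ(Dir_x(X)) ≅ ℙ^{t−1}_{k(x)}`, PROVED** — discharges the named fact `ProjDir_projSpace_genericResidueField` of
`ProjDirProjectiveSpace.lean`: at a generic point `η_1` of `C_1`, `k(η_1) ≅ Frac(k(x)[T_1, …, T_{t−1}])` compatibly with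
`π^*` (`exists_residueField_iso_fractionRing_of_isGenericPoint` with `t = q + 1`).
[cite: CossartJannsenSaito2020, Def. 6.34 (i), p. 103] -/
theorem ProjDir_projSpace_genericResidueField_holds : ProjDir_projSpace_genericResidueField.{u} := by
  intro X X' _ π x hx t hπ hdir ht η hη
  obtain ⟨q, rfl⟩ : ∃ q, t = q + 1 := ⟨t - 1, by omega⟩
  exact exists_residueField_iso_fractionRing_of_isGenericPoint π x hx hπ hdir η hη

end Literature.AlgebraicGeometry.CossartJannsenSaito2020

end
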